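import Summits.Ventures.PercRepro0.BoxEvents

/-!
# L2 · RIGHT-CONT (continued): continuity of `p ↦ P_p(0 ↔ ∂Λ_n)` and right-continuity of `θ_d`

Cell pub-perc-repro0, seat p2.  Against `Defs.lean` (p5) and `BoxEvents.lean` (G1, this seat):

* G2 : an event determined by finitely many bonds is a finite disjoint union of cylinder events, each of
       `P_p`-probability a monomial in `p`, `1 − p` (`measureReal_cylS`, `measureReal_local`); hence
       `continuous_measureReal_local` and `continuous_toBoundary`;
* G4 : `thetaI_upperSemicontinuous`; and, given L1 (`Monotone (thetaI d)`, proved by p5),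
       `L2_RightCont_of_mono : Monotone (thetaI d) → L2_RightCont d` — the Lean twin of L2.
-/

open MeasureTheory ProbabilityTheory unitInterval
open scoped ENNReal Topology

namespace Summit.Ventures.PercRepro0.L2

open Summit.Ventures.PercRepro0.Defs

variable {d : ℕ}

-- BEGIN BODY

/-! ### Locality of `{0 ↔ ∂Λ_n}` -/

/-- The bonds with both endpoints in the box `Λ_n`. -/
def boxBonds (d n : ℕ) : Set (Sym2 (Vertex d)) := {e | e ∈ bonds d ∧ ∀ v ∈ e, nrm v ≤ n}

/-- There are finitely many bonds inside `Λ_n`. -/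
lemma finite_boxBonds (n : ℕ) : (boxBonds d n).Finite := by
  have hfin : ((fun q : Vertex d × Vertex d => s(q.1, q.2)) ''
      ({x : Vertex d | nrm x ≤ n} ×ˢ {x : Vertex d | nrm x ≤ n})).Finite :=
    ((finite_box (d := d) n).prod (finite_box n)).image _
  refine hfin.subset ?_
  rintro e ⟨-, he⟩
  induction e using Sym2.ind with
  | h x y =>
    exact ⟨(x, y), ⟨he x (Sym2.mem_mk_left x y), he y (Sym2.mem_mk_right x y)⟩, rfl⟩

/-- Connections inside `Λ_n` depend only on the states of the bonds inside `Λ_n`. -/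
lemma connIn_local {n : ℕ} {ω ω' : Config d} (h : ∀ e ∈ boxBonds d n, (e ∈ ω ↔ e ∈ ω'))
    {x y : Vertex d} (hc : ConnIn n ω x y) : ConnIn n ω' x y := by
  induction hc with
  | refl => exact Relation.ReflTransGen.refl
  | tail _ hadj ih =>
    refine ih.tail ?_
    obtain ⟨⟨hxz, hmem⟩, hx, hz⟩ := hadj
    refine ⟨⟨hxz, ?_⟩, hx, hz⟩
    rw [← h _ ?_]
    · exact hmem
    · refine ⟨(SimpleGraph.mem_edgeSet (lattice d)).2 hxz, ?_⟩
      intro v hv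
      rcases Sym2.mem_iff.1 hv with rfl | rfl
      · exact hx
      · exact hz

/-- `reach d n` depends only on the states of the bonds inside `Λ_n`. -/
lemma reach_local {n : ℕ} {ω ω' : Config d} (h : ∀ e ∈ boxBonds d n, (e ∈ ω ↔ e ∈ ω'))
    (hω : ω ∈ reach d n) : ω' ∈ reach d n := by
  obtain ⟨y, hy, hc⟩ := hω
  exact ⟨y, hy, connIn_local h hc⟩

/-! ### Cylinder events and their probabilities -/

/-- The configuration prescribed by `η` on `E` (closed outside `E`), as a set of open bonds. -/
def extCfg (E : Finset (Sym2 (Vertex d))) (η : E → Bool) : Config d :=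
  {e | ∃ h : e ∈ E, η ⟨e, h⟩ = true}

/-- The cylinder event "`ω` agrees with `η` on `E`". -/
def cylS (E : Finset (Sym2 (Vertex d))) (η : E → Bool) : Set (Config d) :=
  {ω | ∀ e ∈ E, (e ∈ ω ↔ e ∈ extCfg E η)}

/-- Membership in `extCfg` for bonds of `E`. -/
lemma mem_extCfg {E : Finset (Sym2 (Vertex d))} {η : E → Bool} {e : Sym2 (Vertex d)}
    (he : e ∈ E) : e ∈ extCfg E η ↔ η ⟨e, he⟩ = true := by
  simp [extCfg, he]

/-- Membership in a cylinder event. -/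
lemma mem_cylS {E : Finset (Sym2 (Vertex d))} {η : E → Bool} {ω : Config d} :
    ω ∈ cylS E η ↔ ∀ e : E, ((e : Sym2 (Vertex d)) ∈ ω ↔ η e = true) := by
  simp only [cylS, Set.mem_setOf_eq]
  constructor
  · intro h e
    rw [h e e.2, mem_extCfg e.2]
  · intro h e he
    rw [mem_extCfg he]
    exact h ⟨e, he⟩

/-- Cylinder events are measurable. -/
lemma measurableSet_cylS (E : Finset (Sym2 (Vertex d))) (η : E → Bool) :
    MeasurableSet (cylS E η) := by
  have : cylS E η = ⋂ e : E, {ω : Config d | (e : Sym2 (Vertex d)) ∈ ω ↔ η e = true} := by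
    ext ω
    simp only [mem_cylS, Set.mem_iInter, Set.mem_setOf_eq]
  rw [this]
  refine MeasurableSet.iInter fun e => ?_
  by_cases hη : η e = true
  · simp only [hη, iff_true]
    exact measurableSet_mem _
  · simp only [hη, Bool.false_eq_true, iff_false]
    exact (measurableSet_mem _).compl

/-- Distinct cylinders are disjoint. -/
lemma cylS_pairwiseDisjoint (E : Finset (Sym2 (Vertex d))) :
    Set.PairwiseDisjoint (Set.univ : Set (E → Bool)) (cylS E) := by
  intro η _ η' _ hne
  rw [Function.onFun, Set.disjoint_left]
  intro ω h1 h2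
  apply hne
  funext e
  have h1e := mem_cylS.1 h1 e
  have h2e := mem_cylS.1 h2 e
  cases hη : η e <;> cases hη' : η' e <;> simp_all

/-- The one-bond factor of the product measure behind `setBernoulli`. -/
lemma bernoulliFactor_apply (p : I) {e : Sym2 (Vertex d)} (he : e ∈ bonds d) (q : Bool) :
    (toNNReal p • Measure.dirac (e ∈ bonds d) + toNNReal (σ p) • Measure.dirac False)
      {r : Prop | r ↔ q = true} =
      if q then (toNNReal p : ℝ≥0∞) else (toNNReal (σ p) : ℝ≥0∞) := by
  simp only [Measure.add_apply, Measure.smul_apply, Measure.dirac_apply]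
  cases q
  · have h1 : (e ∈ bonds d) ∉ {r : Prop | r ↔ false = true} := by simp [he]
    have h2 : False ∈ {r : Prop | r ↔ false = true} := by simp
    rw [Set.indicator_of_notMem h1, Set.indicator_of_mem h2]
    simp
  · have h1 : (e ∈ bonds d) ∈ {r : Prop | r ↔ true = true} := by simp [he]
    have h2 : False ∉ {r : Prop | r ↔ true = true} := by simp
    rw [Set.indicator_of_mem h1, Set.indicator_of_notMem h2]
    simp

/-- The `P_p`-probability of a cylinder event on bonds is a monomial in `p` and `1 − p`. -/
lemma measure_cylS (E : Finset (Sym2 (Vertex d))) (hE : ∀ e ∈ E, e ∈ bonds d) (η : E → Bool)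
    (p : I) :
    P d p (cylS E η) = ∏ e : E, (if η e then (toNNReal p : ℝ≥0∞) else (toNNReal (σ p) : ℝ≥0∞)) := by
  unfold P
  rw [setBernoulli_apply']
  have hpre : (fun P : Sym2 (Vertex d) → Prop => {i | P i}) ⁻¹' cylS E η =
      Set.pi (↑E) fun e => {r : Prop | r ↔ e ∈ extCfg E η} := by
    ext P
    simp [cylS, Set.mem_pi]
  rw [hpre, Measure.infinitePi_pi _ fun e _ => MeasurableSpace.measurableSet_top,
    ← Finset.prod_coe_sort]
  refine Finset.prod_congr rfl fun e _ => ?_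
  have hset : {r : Prop | r ↔ (e : Sym2 (Vertex d)) ∈ extCfg E η} = {r : Prop | r ↔ η e = true} := by
    ext r
    simp only [Set.mem_setOf_eq, mem_extCfg e.2]
  rw [hset]
  exact bernoulliFactor_apply p (hE e e.2) (η e)

/-- Real form of `measure_cylS`. -/
lemma measureReal_cylS (E : Finset (Sym2 (Vertex d))) (hE : ∀ e ∈ E, e ∈ bonds d) (η : E → Bool)
    (p : I) :
    (P d p (cylS E η)).toReal = ∏ e : E, (if η e then (p : ℝ) else 1 - p) := by
  rw [measure_cylS E hE η p, ENNReal.toReal_prod]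
  refine Finset.prod_congr rfl fun e _ => ?_
  cases η e
  · simp [unitInterval.coe_symm_eq]
  · simp

/-- The finite set of restrictions `η : E → Bool` whose extension lies in `A`. -/
noncomputable def locSet (E : Finset (Sym2 (Vertex d))) (A : Set (Config d)) : Finset (E → Bool) := by
  classical exact Finset.univ.filter fun η => extCfg E η ∈ A

/-- Membership in `locSet`. -/
lemma mem_locSet {E : Finset (Sym2 (Vertex d))} {A : Set (Config d)} {η : E → Bool} :
    η ∈ locSet E A ↔ extCfg E η ∈ A := by
  classical
  simp [locSet]

/-- An event determined by the bonds of a finite set `E` is the disjoint union of the cylinders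
`cylS E η` over those `η` whose extension lies in the event. -/
lemma local_eq_biUnion {E : Finset (Sym2 (Vertex d))} {A : Set (Config d)}
    (hA : ∀ ω ω' : Config d, (∀ e ∈ E, (e ∈ ω ↔ e ∈ ω')) → ω ∈ A → ω' ∈ A) :
    A = ⋃ η ∈ locSet E A, cylS E η := by
  classical
  ext ω
  simp only [Set.mem_iUnion, exists_prop, mem_locSet]
  constructor
  · intro hω
    refine ⟨fun e => decide ((e : Sym2 (Vertex d)) ∈ ω), ?_, ?_⟩
    · refine hA ω _ ?_ hω
      intro e he
      rw [mem_extCfg he]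
      simp
    · exact mem_cylS.2 fun e => by simp
  · rintro ⟨η, hη, hω⟩
    refine hA (extCfg E η) ω ?_ hη
    intro e he
    rw [mem_extCfg he, (mem_cylS.1 hω ⟨e, he⟩)]

/-- G2 (general form): the `P_p`-probability of an event determined by finitely many bonds is a
polynomial in `p`, written as a finite sum of monomials. -/
lemma measureReal_local (E : Finset (Sym2 (Vertex d))) (hE : ∀ e ∈ E, e ∈ bonds d)
    {A : Set (Config d)} (hA : ∀ ω ω' : Config d, (∀ e ∈ E, (e ∈ ω ↔ e ∈ ω')) → ω ∈ A → ω' ∈ A)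
    (p : I) :
    (P d p A).toReal = ∑ η ∈ locSet E A, ∏ e : E, (if η e then (p : ℝ) else 1 - p) := by
  calc (P d p A).toReal
      = (P d p (⋃ η ∈ locSet E A, cylS E η)).toReal := by rw [← local_eq_biUnion hA]
    _ = ∑ η ∈ locSet E A, (P d p (cylS E η)).toReal := by
        rw [← measureReal_def, measureReal_biUnion_finset
          ((cylS_pairwiseDisjoint E).subset (Set.subset_univ _)) (fun η _ => measurableSet_cylS E η)]
        simp only [measureReal_def]
    _ = ∑ η ∈ locSet E A, ∏ e : E, (if η e then (p : ℝ) else 1 - p) :=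
        Finset.sum_congr rfl fun η _ => measureReal_cylS E hE η p

/-- G2: the `P_p`-probability of an event determined by finitely many bonds is continuous in `p`. -/
lemma continuous_measureReal_local (E : Finset (Sym2 (Vertex d))) (hE : ∀ e ∈ E, e ∈ bonds d)
    {A : Set (Config d)}
    (hA : ∀ ω ω' : Config d, (∀ e ∈ E, (e ∈ ω ↔ e ∈ ω')) → ω ∈ A → ω' ∈ A) :
    Continuous fun p : I => (P d p A).toReal := by
  have : (fun p : I => (P d p A).toReal) = fun p : I =>
      ∑ η ∈ locSet E A, ∏ e : E, (if η e then (p : ℝ) else 1 - p) :=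
    funext fun p => measureReal_local E hE hA p
  rw [this]
  refine continuous_finsetSum _ fun η _ => continuous_finsetProd _ fun e _ => ?_
  cases η e
  · exact continuous_const.sub continuous_subtype_val
  · exact continuous_subtype_val

/-- G2 for `reach d n`: `p ↦ P_p(reach d n)` is continuous on `[0,1]`. -/
lemma continuous_reach (n : ℕ) : Continuous fun p : I => (P d p (reach d n)).toReal := by
  refine continuous_measureReal_local (finite_boxBonds (d := d) n).toFinset
    (fun e he => ((finite_boxBonds n).mem_toFinset.1 he).1) fun ω ω' h => ?_
  refine reach_local fun e he => h e ?_
  exact (finite_boxBonds n).mem_toFinset.2 he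

/-- G2 for `{0 ↔ ∂Λ_n}` (`n ≥ 1`): `p ↦ P_p(0 ↔ ∂Λ_n)` is continuous on `[0,1]`. -/
lemma continuous_toBoundary {n : ℕ} (hn : 1 ≤ n) :
    Continuous fun p : I => (P d p (toBoundary d n)).toReal := by
  rw [toBoundary_eq_reach hn]
  exact continuous_reach n

/-! ### Right-continuity (G4) -/

/-- A useful consequence of `tendsto_toBoundary`: every level `b > θ_d(p)` is exceeded by some
`P_p(0 ↔ ∂Λ_n)` with `n ≥ 1` from below. -/
lemma exists_toBoundary_lt (p : I) {b : ℝ} (hb : thetaI d p < b) :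
    ∃ n, 1 ≤ n ∧ (P d p (toBoundary d n)).toReal < b := by
  have h := (tendsto_order.1 (tendsto_toBoundary (d := d) p)).2 b hb
  obtain ⟨n, hn1, hn2⟩ := (h.and (Filter.eventually_ge_atTop 1)).exists
  exact ⟨n, hn2, hn1⟩

/-- G4 (upper semicontinuity form): `θ_d` is upper semicontinuous on `[0,1]`. -/
theorem thetaI_upperSemicontinuous (d : ℕ) : UpperSemicontinuous (thetaI d) := by
  intro p b hb
  obtain ⟨n, hn, hlt⟩ := exists_toBoundary_lt (d := d) p hb
  have hcont := (continuous_toBoundary (d := d) hn).continuousAt (x := p)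
  exact ((tendsto_order.1 hcont).2 b hlt).mono fun q hq =>
    lt_of_le_of_lt (thetaI_le_toBoundary q hn) hq

/-- G4 on the unit interval: given L1 (monotonicity), `θ_d(q) → θ_d(p)` as `q ↓ p`. -/
theorem thetaI_rightContinuous_of_mono (hmono : Monotone (thetaI d)) (p : I) :
    Filter.Tendsto (thetaI d) (𝓝[>] p) (𝓝 (thetaI d p)) := by
  rw [tendsto_order]
  constructor
  · intro a ha
    exact eventually_nhdsWithin_of_forall fun q hq => lt_of_lt_of_le ha (hmono (le_of_lt hq))
  · intro b hb
    obtain ⟨n, hn, hlt⟩ := exists_toBoundary_lt (d := d) p hb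
    have hcont : Filter.Tendsto (fun q : I => (P d q (toBoundary d n)).toReal)
        (𝓝[>] p) (𝓝 ((P d p (toBoundary d n)).toReal)) :=
      ((continuous_toBoundary (d := d) hn).tendsto p).mono_left nhdsWithin_le_nhds
    exact ((tendsto_order.1 hcont).2 b hlt).mono fun q hq =>
      lt_of_le_of_lt (thetaI_le_toBoundary q hn) hq

/-- Clamping maps `(p, ∞)` into `(clamp p, 1]` when `p < 1`, continuously. -/
lemma tendsto_clamp_Ioi {p : ℝ} (h0 : 0 ≤ p) (h1 : p < 1) :
    Filter.Tendsto clamp (𝓝[Set.Ioi p] p) (𝓝[>] (clamp p)) := by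
  refine tendsto_nhdsWithin_iff.2 ⟨?_, ?_⟩
  · exact (continuous_projIcc.tendsto p).mono_left nhdsWithin_le_nhds
  · refine eventually_nhdsWithin_of_forall fun q hq => ?_
    have hq' : p < q := hq
    rw [Set.mem_Ioi, ← Subtype.coe_lt_coe]
    simp only [clamp, Set.coe_projIcc]
    rw [min_eq_right h1.le, max_eq_right h0, max_eq_right (le_min zero_le_one (h0.trans hq'.le))]
    exact lt_min h1 hq'

/-- G4 on `ℝ` (second half of `L2_RightCont`): given L1, `θ_d` is right-continuous at every
`p ∈ [0,1)`. -/
theorem theta_continuousWithinAt_Ioi_of_mono (hmono : Monotone (thetaI d)) (p : ℝ) (h0 : 0 ≤ p)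
    (h1 : p < 1) : ContinuousWithinAt (theta d) (Set.Ioi p) p :=
  (thetaI_rightContinuous_of_mono hmono (clamp p)).comp (tendsto_clamp_Ioi h0 h1)

/-- L2 · RIGHT-CONT (Lean twin), given L1: `L2_RightCont d`. -/
theorem L2_RightCont_of_mono (hmono : Monotone (thetaI d)) : L2_RightCont d :=
  ⟨tendsto_toBoundary, theta_continuousWithinAt_Ioi_of_mono hmono⟩

-- END BODY

end Summit.Ventures.PercRepro0.L2
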